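import Literature.Geometry.Riemannian.MetricFlowSliceGW1
import Literature.Geometry.Riemannian.MetricFlowVarianceMonotone
import HarnessLib

/-!
# The cross distance of `Z = 𝒳_s ⊔ 𝒳_t` near `W` (Bamler 2023, §4.2, Lemma (construction of
# `Z`), (4.12)–(4.13))

R. Bamler, *Compactness theory of the space of super Ricci flows*, Invent. Math. 233 (2023), §4.2,
proof of the Lemma (construction of `Z`), second part: *"for any `x ∈ 𝒳_s` and `y ∈ W^δ` there is
a `y' ∈ W` with `d_t(y, y') < δ` and therefore, using Proposition 3.24(c),
`d_Z(φ_s(x), φ_t(y)) ≤ d_Z(φ_s(x), φ_t(y')) + δ ≤ d_{W₁}(δ_x, ν_{y';s}) + 2δ ≤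
d_{W₁}(δ_x, ν_{y;s}) + d_{W₁}(ν_{y;s}, ν_{y';s}) + 2δ ≤ d_{W₁}(δ_x, ν_{y;s}) + 3δ ≤
√Var(δ_x, ν_{y;s}) + 3δ`"* (4.12), and the integral bound (4.13)
`∫_{W^δ}∫_{𝒳_s} d_Z(φ_s(x), φ_t(y)) dν_{y;s}(x) dμ_t(y) ≤ √(H(t − s)) + 3δ`. For (4.13) we use the
pointwise `Var(ν_{y;s}) ≤ H(t − s)` (H-concentration) after Jensen on `ν_{y;s}`, which gives the
printed bound directly:

* `lintegral_rpow_half_le` — Jensen/Cauchy–Schwarz `∫ g^{1/2} dν ≤ (∫ g dν)^{1/2}` on a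
  probability space;
* `MetricFlow.edist_inl_inr_le_sqrt_variance_add` — **(4.12)**;
* `MetricFlow.IsHConcentrated.setLIntegral_lintegral_edist_inl_inr_le` — **(4.13)**;
* `MetricFlow.IsHConcentrated.setLIntegral_compl_lintegral_edist_inl_inr_le` — **(4.14)**, the
  bound off `W^δ`: with `μ_t(W^δ) ≥ 1/2`,
  `∫_{𝒳_t ∖ W^δ}∫ d_Z dν_{y;s} dμ_t ≤ 2 (μ_t(𝒳_t ∖ W^δ)^{1/2} (√(Var(μ_t) + H(t − s)) + √Var(μ_t))
  + 3δ μ_t(𝒳_t ∖ W^δ))` (averaging over `w ∈ W^δ`, the triangle inequality through `φ_t(w)`,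
  Cauchy–Schwarz twice and `∫∫ Var(ν_{y;s}, ν_{w;s}) dμ_t dμ_t = Var(μ_s) ≤ Var(μ_t) + H(t − s)`);
* `MetricFlow.IsHConcentrated.lintegral_lintegral_edist_inl_inr_le` — (4.13) + (4.14);
* `MetricFlow.IsHConcentrated.lintegral_lintegral_edist_inl_inr_le_ofReal` — **(4.8)**: under
  `t − s ≤ δ ≤ 1/2`, `Var(μ_t) ≤ V`, `μ_t(𝒳_t ∖ W^δ) ≤ δ` (the hypotheses (4.10) of the Lemma),
  `∫_{𝒳_t}∫_{𝒳_s} d_Z(φ_s(x), φ_t(y)) dν_{y;s}(x) dμ_t(y) ≤ Ψ(H, V, δ)` with the explicit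
  `Ψ(H, V, δ) := √(Hδ) + 3δ + 2(√δ (√(V + Hδ) + √V) + 3δ²) → 0` (`δ → 0`) — the printed
  `√(Hδ) + 3δ` plus `2√δ √(V + Hδ) + 3δ` up to the bookkeeping of the averaging factor `2`.

Everything is proved; no definitions, no named facts.

## References

* R. H. Bamler, *Compactness theory of the space of super Ricci flows*, Invent. Math. 233 (2023),
  §4.2, Lemma (construction of `Z`), proof, (4.12), (4.13). [Bamler2023]
-/

noncomputable section

open Set MeasureTheory ProbabilityTheory Filter Topology Metric
open scoped ENNReal NNReal

namespace Literature.Geometry.Riemannian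

universe u

/-- **Jensen / Cauchy–Schwarz on a probability space**: `∫ g^{1/2} dν ≤ (∫ g dν)^{1/2}` for
a.e.-measurable `g ≥ 0` (Hölder with exponents `(2, 2)` against `1`). [folklore] -/
theorem lintegral_rpow_half_le {X : Type*} [MeasurableSpace X] (ν : Measure X)
    [IsProbabilityMeasure ν] {g : X → ℝ≥0∞} (hg : AEMeasurable g ν) :
    ∫⁻ x, g x ^ (1 / 2 : ℝ) ∂ν ≤ (∫⁻ x, g x ∂ν) ^ (1 / 2 : ℝ) := by
  have hH := ENNReal.lintegral_mul_le_Lp_mul_Lq ν Real.HolderConjugate.two_two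
    (hg.pow_const (1 / 2 : ℝ)) (g := fun _ ↦ (1 : ℝ≥0∞)) measurable_const.aemeasurable
  simp only [mul_one, ENNReal.one_rpow, lintegral_const, measure_univ] at hH
  have h2 : ∀ x, (g x ^ (1 / 2 : ℝ)) ^ (2 : ℝ) = g x := fun x ↦ by
    rw [← ENNReal.rpow_mul]; norm_num
  simp_rw [h2] at hH
  simpa using hH

namespace MetricFlow

variable {I : Set ℝ} {𝒳 : MetricFlow.{u} I}

/-- **(4.12)**: in `Z = 𝒳_s ⊔ 𝒳_t` (Lemma (construction of `Z`), `W ⊆ 𝒳_t` nonempty with (4.9),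
`δ > 0`), for `x ∈ 𝒳_s` and `y` in the open `δ`-neighbourhood `W^δ` of `W`,
`d_Z(φ_s(x), φ_t(y)) ≤ √Var(δ_x, ν_{y;s}) + 3δ`.
[cite: Bamler2023, §4.2, Lemma (construction of Z), proof, (4.12)] -/
theorem edist_inl_inr_le_sqrt_variance_add {s t : I} [CompactSpace (𝒳.Slice s)]
    (hst : (s : ℝ) ≤ t) {W : Set (𝒳.Slice t)} (hW : W.Nonempty) {δ : ℝ} (hδ : 0 < δ)
    (h49 : ∀ w₁ ∈ W, ∀ w₂ ∈ W, edist w₁ w₂ ≤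
      wassersteinW1 (𝒳.condKernel w₁ s) (𝒳.condKernel w₂ s) + ENNReal.ofReal δ)
    (x : 𝒳.Slice s) {y : 𝒳.Slice t} (hy : y ∈ thickening δ W) :
    edist (CrossMetricSum.inl (𝒳.sliceCost_hyp hst hW hδ h49) x)
        (CrossMetricSum.inr (𝒳.sliceCost_hyp hst hW hδ h49) y) ≤
      (variance (Measure.dirac x) (𝒳.condKernel y s)) ^ (1 / 2 : ℝ) + ENNReal.ofReal (3 * δ) := by
  haveI : SecondCountableTopology (𝒳.Slice s) := UniformSpace.secondCountable_of_separable _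
  haveI : ∀ w : 𝒳.Slice t, IsProbabilityMeasure (𝒳.condKernel w s) := fun w ↦
    𝒳.isProbabilityMeasure_condKernel w hst
  set h := 𝒳.sliceCost_hyp hst hW hδ h49
  obtain ⟨y', hy', hyy'⟩ := mem_thickening_iff.1 hy
  have hdy : edist y y' ≤ ENNReal.ofReal δ := by
    rw [edist_dist]; exact ENNReal.ofReal_le_ofReal hyy'.le
  have h3 : ENNReal.ofReal (3 * δ) = ENNReal.ofReal δ + ENNReal.ofReal δ + ENNReal.ofReal δ := by
    rw [← ENNReal.ofReal_add hδ.le hδ.le, ← ENNReal.ofReal_add (by linarith) hδ.le]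
    ring_nf
  calc edist (CrossMetricSum.inl h x) (CrossMetricSum.inr h y)
      ≤ edist (CrossMetricSum.inl h x) (CrossMetricSum.inr h y') +
          edist (CrossMetricSum.inr h y') (CrossMetricSum.inr h y) := edist_triangle _ _ _
    _ = edist (CrossMetricSum.inl h x) (CrossMetricSum.inr h y') + edist y' y := by
        rw [(CrossMetricSum.isometry_inr h).edist_eq]
    _ ≤ (wassersteinW1 (Measure.dirac x) (𝒳.condKernel y' s) + ENNReal.ofReal δ) +
          ENNReal.ofReal δ := by
        gcongr
        · exact 𝒳.edist_inl_inr_le_wassersteinW1_dirac_add hst hW hδ h49 x hy'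
        · rw [edist_comm]; exact hdy
    _ ≤ ((wassersteinW1 (Measure.dirac x) (𝒳.condKernel y s) +
          wassersteinW1 (𝒳.condKernel y s) (𝒳.condKernel y' s)) + ENNReal.ofReal δ) +
          ENNReal.ofReal δ := by
        gcongr
        exact wassersteinW1_triangle _ _ _
    _ ≤ ((wassersteinW1 (Measure.dirac x) (𝒳.condKernel y s) + ENNReal.ofReal δ) +
          ENNReal.ofReal δ) + ENNReal.ofReal δ := by
        gcongr
        exact (𝒳.wassersteinW1_condKernel_le_edist hst y y').trans hdy
    _ ≤ (((variance (Measure.dirac x) (𝒳.condKernel y s)) ^ (1 / 2 : ℝ) + ENNReal.ofReal δ) +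
          ENNReal.ofReal δ) + ENNReal.ofReal δ := by
        gcongr
        exact wassersteinW1_le_sqrt_variance _ _
    _ = _ := by rw [h3]; ring

/-- **(4.13)**: in an `H`-concentrated metric flow with a conjugate heat flow `(μ_t)`, `s ≤ t` in
`I'`, compact `𝒳_s`, and `Z = 𝒳_s ⊔ 𝒳_t` as above,
`∫_{W^δ}∫_{𝒳_s} d_Z(φ_s(x), φ_t(y)) dν_{y;s}(x) dμ_t(y) ≤ √(H(t − s)) + 3δ` — integrate (4.12),
`∫ √Var(δ_x, ν_{y;s}) dν_{y;s}(x) ≤ (∫ Var(δ_x, ν_{y;s}) dν_{y;s}(x))^{1/2} = Var(ν_{y;s})^{1/2} ≤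
√(H(t − s))`. [cite: Bamler2023, §4.2, Lemma (construction of Z), proof, (4.13)] -/
theorem IsHConcentrated.setLIntegral_lintegral_edist_inl_inr_le {H : ℝ} (hH : 𝒳.IsHConcentrated H)
    {I' : Set ℝ} {μ : ∀ t : I, Measure (𝒳.Slice t)} (hμ : 𝒳.IsConjugateHeatFlow I' μ) {s t : I}
    [CompactSpace (𝒳.Slice s)] (ht : (t : ℝ) ∈ I') (hst : (s : ℝ) ≤ t)
    {W : Set (𝒳.Slice t)} (hW : W.Nonempty) {δ : ℝ} (hδ : 0 < δ)
    (h49 : ∀ w₁ ∈ W, ∀ w₂ ∈ W, edist w₁ w₂ ≤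
      wassersteinW1 (𝒳.condKernel w₁ s) (𝒳.condKernel w₂ s) + ENNReal.ofReal δ) :
    ∫⁻ y in thickening δ W, ∫⁻ x, edist (CrossMetricSum.inl (𝒳.sliceCost_hyp hst hW hδ h49) x)
        (CrossMetricSum.inr (𝒳.sliceCost_hyp hst hW hδ h49) y) ∂(𝒳.condKernel y s) ∂(μ t) ≤
      (ENNReal.ofReal (H * ((t : ℝ) - s))) ^ (1 / 2 : ℝ) + ENNReal.ofReal (3 * δ) := by
  haveI := hμ.1 t ht
  haveI : SecondCountableTopology (𝒳.Slice s) := UniformSpace.secondCountable_of_separable _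
  haveI : ∀ w : 𝒳.Slice t, IsProbabilityMeasure (𝒳.condKernel w s) := fun w ↦
    𝒳.isProbabilityMeasure_condKernel w hst
  set h := 𝒳.sliceCost_hyp hst hW hδ h49
  set c : ℝ≥0∞ := (ENNReal.ofReal (H * ((t : ℝ) - s))) ^ (1 / 2 : ℝ) with hc
  -- the pointwise bound on `W^δ`, integrated over `ν_{y;s}`
  have hpt : ∀ y ∈ thickening δ W,
      ∫⁻ x, edist (CrossMetricSum.inl h x) (CrossMetricSum.inr h y) ∂(𝒳.condKernel y s) ≤
        c + ENNReal.ofReal (3 * δ) := by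
    intro y hy
    calc ∫⁻ x, edist (CrossMetricSum.inl h x) (CrossMetricSum.inr h y) ∂(𝒳.condKernel y s)
        ≤ ∫⁻ x, ((variance (Measure.dirac x) (𝒳.condKernel y s)) ^ (1 / 2 : ℝ) +
            ENNReal.ofReal (3 * δ)) ∂(𝒳.condKernel y s) :=
          lintegral_mono fun x ↦ 𝒳.edist_inl_inr_le_sqrt_variance_add hst hW hδ h49 x hy
      _ = ∫⁻ x, (variance (Measure.dirac x) (𝒳.condKernel y s)) ^ (1 / 2 : ℝ) ∂(𝒳.condKernel y s) +
            ENNReal.ofReal (3 * δ) := by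
          rw [lintegral_add_right _ measurable_const, lintegral_const, measure_univ, mul_one]
      _ ≤ (∫⁻ x, variance (Measure.dirac x) (𝒳.condKernel y s) ∂(𝒳.condKernel y s)) ^ (1 / 2 : ℝ) +
            ENNReal.ofReal (3 * δ) :=
          add_le_add (lintegral_rpow_half_le _ (measurable_variance_dirac _).aemeasurable) le_rfl
      _ = (variance (𝒳.condKernel y s) (𝒳.condKernel y s)) ^ (1 / 2 : ℝ) + ENNReal.ofReal (3 * δ) := by
          rw [lintegral_variance_dirac]
      _ ≤ c + ENNReal.ofReal (3 * δ) :=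
          add_le_add (ENNReal.rpow_le_rpow (hH.variance_condKernel_self_le_ofReal hst y)
            (by norm_num)) le_rfl
  -- integrate over `μ_t|_{W^δ}` (total mass `≤ 1`)
  have hS : MeasurableSet (thickening δ W) := isOpen_thickening.measurableSet
  calc ∫⁻ y in thickening δ W, ∫⁻ x, edist (CrossMetricSum.inl h x) (CrossMetricSum.inr h y)
          ∂(𝒳.condKernel y s) ∂(μ t)
      ≤ ∫⁻ _ in thickening δ W, (c + ENNReal.ofReal (3 * δ)) ∂(μ t) :=
        lintegral_mono_ae ((ae_restrict_iff' hS).2 (Eventually.of_forall hpt))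
    _ = (c + ENNReal.ofReal (3 * δ)) * μ t (thickening δ W) := by
        rw [lintegral_const, Measure.restrict_apply_univ]
    _ ≤ (c + ENNReal.ofReal (3 * δ)) * 1 := by gcongr; exact prob_le_one
    _ = c + ENNReal.ofReal (3 * δ) := mul_one _

/-- **(4.14)**, the bound off `W^δ` (Bamler 2023, §4.2, proof of the Lemma (construction of
`Z`), last display): if moreover `μ_t(W^δ) ≥ 1/2`, then
`∫_{𝒳_t ∖ W^δ}∫_{𝒳_s} d_Z(φ_s(x), φ_t(y)) dν_{y;s}(x) dμ_t(y) ≤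
2 (μ_t(𝒳_t ∖ W^δ)^{1/2} ((Var(μ_t) + H(t − s))^{1/2} + Var(μ_t)^{1/2}) + 3δ μ_t(𝒳_t ∖ W^δ))`.
Printed proof: `½ ∫_{∖W^δ}∫ d_Z ≤ ∫_{W^δ}∫_{∖W^δ}∫ (d_Z(φ_s(x), φ_t(w)) + d_t(w, y)) dν_{y;s} dμ_t(y) dμ_t(w)`,
`d_Z(φ_s(x), φ_t(w)) ≤ √Var(δ_x, ν_{w;s}) + 3δ` ((4.12)), Jensen in `x`
(`∫ Var(δ_x, ν_{w;s}) dν_{y;s}(x) = Var(ν_{y;s}, ν_{w;s})`), Cauchy–Schwarz in `(y, w)`,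
`∫∫ Var(ν_{y;s}, ν_{w;s}) dμ_t dμ_t = Var(μ_s) ≤ Var(μ_t) + H(t − s)` and
`∫∫ d_t² dμ_t dμ_t = Var(μ_t)`. [cite: Bamler2023, §4.2, Lemma (construction of Z), proof, (4.14)] -/
theorem IsHConcentrated.setLIntegral_compl_lintegral_edist_inl_inr_le {H : ℝ}
    (hH : 𝒳.IsHConcentrated H) {I' : Set ℝ} {μ : ∀ t : I, Measure (𝒳.Slice t)}
    (hμ : 𝒳.IsConjugateHeatFlow I' μ) {s t : I} [CompactSpace (𝒳.Slice s)] (hs : (s : ℝ) ∈ I')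
    (ht : (t : ℝ) ∈ I') (hst : (s : ℝ) ≤ t) {W : Set (𝒳.Slice t)} (hW : W.Nonempty) {δ : ℝ}
    (hδ : 0 < δ)
    (h49 : ∀ w₁ ∈ W, ∀ w₂ ∈ W, edist w₁ w₂ ≤
      wassersteinW1 (𝒳.condKernel w₁ s) (𝒳.condKernel w₂ s) + ENNReal.ofReal δ)
    (hhalf : 2⁻¹ ≤ μ t (thickening δ W)) :
    ∫⁻ y in (thickening δ W)ᶜ, ∫⁻ x, edist (CrossMetricSum.inl (𝒳.sliceCost_hyp hst hW hδ h49) x)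
        (CrossMetricSum.inr (𝒳.sliceCost_hyp hst hW hδ h49) y) ∂(𝒳.condKernel y s) ∂(μ t) ≤
      2 * ((μ t (thickening δ W)ᶜ) ^ (1 / 2 : ℝ) *
          ((variance (μ t) (μ t) + ENNReal.ofReal (H * ((t : ℝ) - s))) ^ (1 / 2 : ℝ) +
            (variance (μ t) (μ t)) ^ (1 / 2 : ℝ)) +
        ENNReal.ofReal (3 * δ) * μ t (thickening δ W)ᶜ) := by
  haveI := hμ.1 t ht
  haveI : SecondCountableTopology (𝒳.Slice s) := UniformSpace.secondCountable_of_separable _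
  haveI : SecondCountableTopology (𝒳.Slice t) := UniformSpace.secondCountable_of_separable _
  haveI : ∀ w : 𝒳.Slice t, IsProbabilityMeasure (𝒳.condKernel w s) := fun w ↦
    𝒳.isProbabilityMeasure_condKernel w hst
  set h := 𝒳.sliceCost_hyp hst hW hδ h49
  set κ : Kernel (𝒳.Slice t) (𝒳.Slice s) := 𝒳.kernel hst with hκ
  set m : Measure (𝒳.Slice t) := μ t with hm
  set S : Set (𝒳.Slice t) := thickening δ W with hS_def
  set c3 : ℝ≥0∞ := ENNReal.ofReal (3 * δ) with hc3
  have hS : MeasurableSet S := isOpen_thickening.measurableSet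
  have hκy : ∀ y, κ y = 𝒳.condKernel y s := fun y ↦ rfl
  -- measurability of `(y, w) ↦ Var(ν_{y;s}, ν_{w;s})`
  have hd2 : Measurable fun p : 𝒳.Slice s × 𝒳.Slice s ↦ edist p.1 p.2 ^ 2 := measurable_edist_sq
  have hG : Measurable fun p : 𝒳.Slice s × 𝒳.Slice t ↦ ∫⁻ x', edist p.1 x' ^ 2 ∂κ p.2 := by
    have := Measurable.lintegral_kernel_prod_right (κ := κ.comap Prod.snd measurable_snd)
      (f := fun (p : 𝒳.Slice s × 𝒳.Slice t) (x' : 𝒳.Slice s) ↦ edist p.1 x' ^ 2)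
      (hd2.comp ((measurable_fst.comp measurable_fst).prodMk measurable_snd))
    simpa [Kernel.comap_apply] using this
  have hVm : Measurable fun p : 𝒳.Slice t × 𝒳.Slice t ↦ variance (κ p.1) (κ p.2) := by
    have := Measurable.lintegral_kernel_prod_right (κ := κ.comap Prod.fst measurable_fst)
      (f := fun (p : 𝒳.Slice t × 𝒳.Slice t) (x : 𝒳.Slice s) ↦ ∫⁻ x', edist x x' ^ 2 ∂κ p.2)
      (hG.comp (measurable_snd.prodMk (measurable_snd.comp measurable_fst)))
    simpa [Kernel.comap_apply, variance_def] using this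
  have hVm' : Measurable fun p : 𝒳.Slice t × 𝒳.Slice t ↦ variance (κ p.2) (κ p.1) :=
    hVm.comp (measurable_snd.prodMk measurable_fst)
  have hVu : Measurable (Function.uncurry fun (w y : 𝒳.Slice t) ↦ variance (κ y) (κ w)) :=
    hVm.comp (measurable_snd.prodMk measurable_fst)
  -- Step 1: the pointwise bound for `w ∈ W^δ`
  have hVdir : ∀ y w : 𝒳.Slice t, ∫⁻ x, variance (Measure.dirac x) (κ w) ∂κ y = variance (κ y) (κ w) :=
    fun y w ↦ by
    rw [variance_def]
    exact lintegral_congr fun x ↦ variance_dirac_left x _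
  have step1 : ∀ w ∈ S, ∀ y : 𝒳.Slice t,
      ∫⁻ x, edist (CrossMetricSum.inl h x) (CrossMetricSum.inr h y) ∂κ y ≤
        (variance (κ y) (κ w)) ^ (1 / 2 : ℝ) + c3 + edist w y := by
    intro w hw y
    calc ∫⁻ x, edist (CrossMetricSum.inl h x) (CrossMetricSum.inr h y) ∂κ y
        ≤ ∫⁻ x, (edist (CrossMetricSum.inl h x) (CrossMetricSum.inr h w) + edist w y) ∂κ y := by
          refine lintegral_mono fun x ↦ ?_
          calc edist (CrossMetricSum.inl h x) (CrossMetricSum.inr h y)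
              ≤ edist (CrossMetricSum.inl h x) (CrossMetricSum.inr h w) +
                  edist (CrossMetricSum.inr h w) (CrossMetricSum.inr h y) := edist_triangle _ _ _
            _ = _ := by rw [(CrossMetricSum.isometry_inr h).edist_eq]
      _ = ∫⁻ x, edist (CrossMetricSum.inl h x) (CrossMetricSum.inr h w) ∂κ y + edist w y := by
          rw [lintegral_add_right _ measurable_const, lintegral_const, measure_univ, mul_one]
      _ ≤ ∫⁻ x, ((variance (Measure.dirac x) (κ w)) ^ (1 / 2 : ℝ) + c3) ∂κ y + edist w y := by
          gcongr with x
          exact 𝒳.edist_inl_inr_le_sqrt_variance_add hst hW hδ h49 x hw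
      _ = (∫⁻ x, (variance (Measure.dirac x) (κ w)) ^ (1 / 2 : ℝ) ∂κ y + c3) + edist w y := by
          rw [lintegral_add_right _ measurable_const, lintegral_const, measure_univ, mul_one]
      _ ≤ ((∫⁻ x, variance (Measure.dirac x) (κ w) ∂κ y) ^ (1 / 2 : ℝ) + c3) + edist w y := by
          gcongr
          exact lintegral_rpow_half_le _ (measurable_variance_dirac _).aemeasurable
      _ = (variance (κ y) (κ w)) ^ (1 / 2 : ℝ) + c3 + edist w y := by rw [hVdir]
  -- Step 2: average over `w ∈ W^δ`
  set A : ℝ≥0∞ := ∫⁻ y in Sᶜ, ∫⁻ x, edist (CrossMetricSum.inl h x) (CrossMetricSum.inr h y)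
    ∂κ y ∂m with hA
  set F1 : 𝒳.Slice t → ℝ≥0∞ := fun w ↦ ∫⁻ y in Sᶜ, (variance (κ y) (κ w)) ^ (1 / 2 : ℝ) ∂m
    with hF1
  set F2 : 𝒳.Slice t → ℝ≥0∞ := fun w ↦ ∫⁻ y in Sᶜ, edist w y ∂m with hF2
  have hF2m : Measurable F2 := by
    have : Measurable fun p : 𝒳.Slice t × 𝒳.Slice t ↦ edist p.1 p.2 := measurable_edist
    exact this.lintegral_prod_right'
  have step2 : m S * A ≤ ∫⁻ w in S, F1 w ∂m + c3 * m Sᶜ * m S + ∫⁻ w in S, F2 w ∂m := by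
    have hin : ∀ w ∈ S, ∫⁻ y in Sᶜ, ∫⁻ x, edist (CrossMetricSum.inl h x) (CrossMetricSum.inr h y)
        ∂κ y ∂m ≤ F1 w + c3 * m Sᶜ + F2 w := by
      intro w hw
      calc ∫⁻ y in Sᶜ, ∫⁻ x, edist (CrossMetricSum.inl h x) (CrossMetricSum.inr h y) ∂κ y ∂m
          ≤ ∫⁻ y in Sᶜ, ((variance (κ y) (κ w)) ^ (1 / 2 : ℝ) + c3 + edist w y) ∂m :=
            lintegral_mono fun y ↦ step1 w hw y
        _ = F1 w + c3 * m Sᶜ + F2 w := by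
            rw [lintegral_add_right _
                (show Measurable (fun y : 𝒳.Slice t ↦ edist w y) from
                  measurable_const.edist measurable_id),
              lintegral_add_right _ measurable_const, setLIntegral_const]
    calc m S * A = ∫⁻ _ in S, A ∂m := by rw [setLIntegral_const, mul_comm]
      _ ≤ ∫⁻ w in S, (F1 w + c3 * m Sᶜ + F2 w) ∂m :=
          lintegral_mono_ae ((ae_restrict_iff' hS).2 (Eventually.of_forall hin))
      _ = ∫⁻ w in S, F1 w ∂m + c3 * m Sᶜ * m S + ∫⁻ w in S, F2 w ∂m := by
          rw [lintegral_add_right _ hF2m, lintegral_add_right _ measurable_const, setLIntegral_const]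
  -- Step 3: Cauchy–Schwarz on `S × Sᶜ`
  set π : Measure (𝒳.Slice t × 𝒳.Slice t) := (m.restrict S).prod (m.restrict Sᶜ) with hπ
  have hπu : π univ = m S * m Sᶜ := by
    rw [hπ, ← univ_prod_univ, Measure.prod_prod, Measure.restrict_apply_univ,
      Measure.restrict_apply_univ]
  have hCS : ∀ {f : 𝒳.Slice t × 𝒳.Slice t → ℝ≥0∞}, Measurable f →
      ∫⁻ p, f p ∂π ≤ (∫⁻ p, f p ^ (2 : ℝ) ∂π) ^ (1 / 2 : ℝ) * (m S * m Sᶜ) ^ (1 / 2 : ℝ) := by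
    intro f hf
    have hH' := ENNReal.lintegral_mul_le_Lp_mul_Lq π Real.HolderConjugate.two_two
      hf.aemeasurable (g := fun _ ↦ (1 : ℝ≥0∞)) measurable_const.aemeasurable
    simp only [ENNReal.one_rpow, lintegral_const, hπu] at hH'
    simpa using hH'
  -- Step 3a: `T1`
  have hT1 : ∫⁻ w in S, F1 w ∂m ≤
      (variance (m) (m) + ENNReal.ofReal (H * ((t : ℝ) - s))) ^ (1 / 2 : ℝ) *
        (m S * m Sᶜ) ^ (1 / 2 : ℝ) := by
    have hf : Measurable fun p : 𝒳.Slice t × 𝒳.Slice t ↦ (variance (κ p.2) (κ p.1)) ^ (1 / 2 : ℝ) :=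
      hVm'.pow_const _
    have h1 : ∫⁻ w in S, F1 w ∂m = ∫⁻ p, (variance (κ p.2) (κ p.1)) ^ (1 / 2 : ℝ) ∂π := by
      rw [hπ, lintegral_prod _ hf.aemeasurable]
    have h2 : ∫⁻ p, ((variance (κ p.2) (κ p.1)) ^ (1 / 2 : ℝ)) ^ (2 : ℝ) ∂π ≤
        variance m m + ENNReal.ofReal (H * ((t : ℝ) - s)) := by
      have h21 : ∀ p : 𝒳.Slice t × 𝒳.Slice t,
          ((variance (κ p.2) (κ p.1)) ^ (1 / 2 : ℝ)) ^ (2 : ℝ) = variance (κ p.2) (κ p.1) := fun p ↦ by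
        rw [← ENNReal.rpow_mul]; norm_num
      simp_rw [h21]
      calc ∫⁻ p, variance (κ p.2) (κ p.1) ∂π
          = ∫⁻ w in S, ∫⁻ y in Sᶜ, variance (κ y) (κ w) ∂m ∂m := by
            rw [hπ, lintegral_prod _ hVm'.aemeasurable]
        _ ≤ ∫⁻ w, ∫⁻ y, variance (κ y) (κ w) ∂m ∂m := by
            refine (lintegral_mono' Measure.restrict_le_self le_rfl).trans ?_
            exact lintegral_mono fun w ↦ lintegral_mono' Measure.restrict_le_self le_rfl
        _ = ∫⁻ y, ∫⁻ w, variance (κ y) (κ w) ∂m ∂m :=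
            lintegral_lintegral_swap hVu.aemeasurable
        _ = variance (κ ∘ₘ m) (κ ∘ₘ m) := (variance_comp_comp κ κ m m).symm
        _ = variance (μ s) (μ s) := by rw [← hμ.eq_bind hs ht hst]
        _ ≤ variance m m + ENNReal.ofReal (H * ((t : ℝ) - s)) :=
            hH.variance_le_variance_add hμ hμ hs ht hst
    rw [h1]
    refine (hCS hf).trans ?_
    gcongr
  -- Step 3b: `T2`
  have hT2 : ∫⁻ w in S, F2 w ∂m ≤ (variance m m) ^ (1 / 2 : ℝ) * (m S * m Sᶜ) ^ (1 / 2 : ℝ) := by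
    have hf : Measurable fun p : 𝒳.Slice t × 𝒳.Slice t ↦ edist p.1 p.2 := measurable_edist
    have h1 : ∫⁻ w in S, F2 w ∂m = ∫⁻ p, edist p.1 p.2 ∂π := by
      rw [hπ, lintegral_prod _ hf.aemeasurable]
    have h2 : ∫⁻ p, (edist p.1 p.2) ^ (2 : ℝ) ∂π ≤ variance m m := by
      simp_rw [ENNReal.rpow_two]
      calc ∫⁻ p, edist p.1 p.2 ^ 2 ∂π = ∫⁻ w in S, ∫⁻ y in Sᶜ, edist w y ^ 2 ∂m ∂m := by
            rw [hπ, lintegral_prod _ measurable_edist_sq.aemeasurable]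
        _ ≤ ∫⁻ w, ∫⁻ y, edist w y ^ 2 ∂m ∂m := by
            refine (lintegral_mono' Measure.restrict_le_self le_rfl).trans ?_
            exact lintegral_mono fun w ↦ lintegral_mono' Measure.restrict_le_self le_rfl
        _ = variance m m := (variance_def m m).symm
    rw [h1]
    refine (hCS hf).trans ?_
    gcongr
  -- Step 4: assemble
  have hmS1 : m S ≤ 1 := prob_le_one
  have hprod : (m S * m Sᶜ) ^ (1 / 2 : ℝ) ≤ (m Sᶜ) ^ (1 / 2 : ℝ) := by
    refine ENNReal.rpow_le_rpow ?_ (by norm_num)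
    calc m S * m Sᶜ ≤ 1 * m Sᶜ := by gcongr
      _ = m Sᶜ := one_mul _
  have hkey : m S * A ≤ (m Sᶜ) ^ (1 / 2 : ℝ) *
      ((variance m m + ENNReal.ofReal (H * ((t : ℝ) - s))) ^ (1 / 2 : ℝ) +
        (variance m m) ^ (1 / 2 : ℝ)) + c3 * m Sᶜ := by
    calc m S * A ≤ ∫⁻ w in S, F1 w ∂m + c3 * m Sᶜ * m S + ∫⁻ w in S, F2 w ∂m := step2
      _ ≤ (variance m m + ENNReal.ofReal (H * ((t : ℝ) - s))) ^ (1 / 2 : ℝ) * (m Sᶜ) ^ (1 / 2 : ℝ) +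
            c3 * m Sᶜ * 1 + (variance m m) ^ (1 / 2 : ℝ) * (m Sᶜ) ^ (1 / 2 : ℝ) := by
          gcongr
          · exact hT1.trans (by gcongr)
          · exact hT2.trans (by gcongr)
      _ = _ := by ring
  -- `A ≤ 2 (m S) A`
  have h2S : 1 ≤ 2 * m S := by
    calc (1 : ℝ≥0∞) = 2 * 2⁻¹ := by rw [ENNReal.mul_inv_cancel two_ne_zero ENNReal.ofNat_ne_top]
      _ ≤ 2 * m S := by gcongr
  calc A = 1 * A := (one_mul _).symm
    _ ≤ (2 * m S) * A := by gcongr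
    _ = 2 * (m S * A) := by ring
    _ ≤ 2 * ((m Sᶜ) ^ (1 / 2 : ℝ) *
          ((variance m m + ENNReal.ofReal (H * ((t : ℝ) - s))) ^ (1 / 2 : ℝ) +
            (variance m m) ^ (1 / 2 : ℝ)) + c3 * m Sᶜ) := by gcongr

/-- **(4.13) + (4.14)**: the total cross integral
`∫_{𝒳_t}∫_{𝒳_s} d_Z(φ_s(x), φ_t(y)) dν_{y;s}(x) dμ_t(y)` is at most
`√(H(t − s)) + 3δ + 2 (μ_t(𝒳_t ∖ W^δ)^{1/2} ((Var(μ_t) + H(t − s))^{1/2} + Var(μ_t)^{1/2}) + 3δ μ_t(𝒳_t ∖ W^δ))`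
when `μ_t(W^δ) ≥ 1/2`. [cite: Bamler2023, §4.2, Lemma (construction of Z), proof, (4.13)–(4.14)] -/
theorem IsHConcentrated.lintegral_lintegral_edist_inl_inr_le {H : ℝ}
    (hH : 𝒳.IsHConcentrated H) {I' : Set ℝ} {μ : ∀ t : I, Measure (𝒳.Slice t)}
    (hμ : 𝒳.IsConjugateHeatFlow I' μ) {s t : I} [CompactSpace (𝒳.Slice s)] (hs : (s : ℝ) ∈ I')
    (ht : (t : ℝ) ∈ I') (hst : (s : ℝ) ≤ t) {W : Set (𝒳.Slice t)} (hW : W.Nonempty) {δ : ℝ}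
    (hδ : 0 < δ)
    (h49 : ∀ w₁ ∈ W, ∀ w₂ ∈ W, edist w₁ w₂ ≤
      wassersteinW1 (𝒳.condKernel w₁ s) (𝒳.condKernel w₂ s) + ENNReal.ofReal δ)
    (hhalf : 2⁻¹ ≤ μ t (thickening δ W)) :
    ∫⁻ y, ∫⁻ x, edist (CrossMetricSum.inl (𝒳.sliceCost_hyp hst hW hδ h49) x)
        (CrossMetricSum.inr (𝒳.sliceCost_hyp hst hW hδ h49) y) ∂(𝒳.condKernel y s) ∂(μ t) ≤
      ((ENNReal.ofReal (H * ((t : ℝ) - s))) ^ (1 / 2 : ℝ) + ENNReal.ofReal (3 * δ)) +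
      2 * ((μ t (thickening δ W)ᶜ) ^ (1 / 2 : ℝ) *
          ((variance (μ t) (μ t) + ENNReal.ofReal (H * ((t : ℝ) - s))) ^ (1 / 2 : ℝ) +
            (variance (μ t) (μ t)) ^ (1 / 2 : ℝ)) +
        ENNReal.ofReal (3 * δ) * μ t (thickening δ W)ᶜ) := by
  have hS : MeasurableSet (thickening δ W) := isOpen_thickening.measurableSet
  rw [← lintegral_add_compl _ hS]
  exact add_le_add (hH.setLIntegral_lintegral_edist_inl_inr_le hμ ht hst hW hδ h49)
    (hH.setLIntegral_compl_lintegral_edist_inl_inr_le hμ hs ht hst hW hδ h49 hhalf)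

/-- **Bamler 2023, (4.8) via the Lemma (construction of `Z`), second part**: if `H ≥ 0`,
`0 < δ ≤ 1/2`, `t − s ≤ δ`, `Var(μ_t) ≤ V` and `μ_t(𝒳_t ∖ W^δ) ≤ δ` ((4.10)), then
`∫_{𝒳_t}∫_{𝒳_s} d_Z(φ_s(x), φ_t(y)) dν_{y;s}(x) dμ_t(y) ≤ Ψ(H, V, δ) :=
√(Hδ) + 3δ + 2(√δ (√(V + Hδ) + √V) + 3δ²)`, an explicit function with `Ψ → 0` as `δ → 0`
(so (4.8) holds once `δ ≤ δ̄(H, V, ε)`). [cite: Bamler2023, §4.2, Lemma (construction of Z), second part; Proposition, (4.8)] -/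
theorem IsHConcentrated.lintegral_lintegral_edist_inl_inr_le_ofReal {H : ℝ}
    (hH : 𝒳.IsHConcentrated H) (hH0 : 0 ≤ H) {I' : Set ℝ} {μ : ∀ t : I, Measure (𝒳.Slice t)}
    (hμ : 𝒳.IsConjugateHeatFlow I' μ) {s t : I} [CompactSpace (𝒳.Slice s)] (hs : (s : ℝ) ∈ I')
    (ht : (t : ℝ) ∈ I') (hst : (s : ℝ) ≤ t) {W : Set (𝒳.Slice t)} (hW : W.Nonempty) {δ : ℝ}
    (hδ : 0 < δ) (hδ2 : δ ≤ 1 / 2)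
    (h49 : ∀ w₁ ∈ W, ∀ w₂ ∈ W, edist w₁ w₂ ≤
      wassersteinW1 (𝒳.condKernel w₁ s) (𝒳.condKernel w₂ s) + ENNReal.ofReal δ)
    (hts : (t : ℝ) - s ≤ δ) {V : ℝ} (hV : 0 ≤ V) (hVar : variance (μ t) (μ t) ≤ ENNReal.ofReal V)
    (hWδ : μ t (thickening δ W)ᶜ ≤ ENNReal.ofReal δ) :
    ∫⁻ y, ∫⁻ x, edist (CrossMetricSum.inl (𝒳.sliceCost_hyp hst hW hδ h49) x)
        (CrossMetricSum.inr (𝒳.sliceCost_hyp hst hW hδ h49) y) ∂(𝒳.condKernel y s) ∂(μ t) ≤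
      ENNReal.ofReal (Real.sqrt (H * δ) + 3 * δ +
        2 * (Real.sqrt δ * (Real.sqrt (V + H * δ) + Real.sqrt V) + 3 * δ * δ)) := by
  haveI := hμ.1 t ht
  have hS : MeasurableSet (thickening δ W) := isOpen_thickening.measurableSet
  -- `μ_t(W^δ) ≥ 1/2`
  have hhalf : 2⁻¹ ≤ μ t (thickening δ W) := by
    have hSeq : μ t (thickening δ W) = 1 - μ t (thickening δ W)ᶜ := by
      rw [← prob_compl_eq_one_sub hS.compl, compl_compl]
    have h1 : μ t (thickening δ W)ᶜ ≤ 2⁻¹ := by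
      refine hWδ.trans ?_
      rw [← ENNReal.ofReal_ofNat 2, ← ENNReal.ofReal_inv_of_pos two_pos]
      exact ENNReal.ofReal_le_ofReal (by linarith)
    calc (2⁻¹ : ℝ≥0∞) = 1 - 2⁻¹ := ENNReal.one_sub_inv_two.symm
      _ ≤ 1 - μ t (thickening δ W)ᶜ := tsub_le_tsub_left h1 _
      _ = μ t (thickening δ W) := hSeq.symm
  have hmain := hH.lintegral_lintegral_edist_inl_inr_le hμ hs ht hst hW hδ h49 hhalf
  refine hmain.trans ?_
  -- compare term by term
  have hHts : ENNReal.ofReal (H * ((t : ℝ) - s)) ≤ ENNReal.ofReal (H * δ) :=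
    ENNReal.ofReal_le_ofReal (mul_le_mul_of_nonneg_left hts hH0)
  have hsq : ∀ {a : ℝ≥0∞} {r : ℝ}, 0 ≤ r → a ≤ ENNReal.ofReal r →
      a ^ (1 / 2 : ℝ) ≤ ENNReal.ofReal (Real.sqrt r) := fun {a r} hr har ↦ by
    calc a ^ (1 / 2 : ℝ) ≤ (ENNReal.ofReal r) ^ (1 / 2 : ℝ) := ENNReal.rpow_le_rpow har (by norm_num)
      _ = ENNReal.ofReal (Real.sqrt r) := by
          rw [ENNReal.ofReal_rpow_of_nonneg hr (by norm_num), Real.sqrt_eq_rpow]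
  have h1 : (ENNReal.ofReal (H * ((t : ℝ) - s))) ^ (1 / 2 : ℝ) ≤ ENNReal.ofReal (Real.sqrt (H * δ)) :=
    hsq (by positivity) hHts
  have h2 : (μ t (thickening δ W)ᶜ) ^ (1 / 2 : ℝ) ≤ ENNReal.ofReal (Real.sqrt δ) := hsq hδ.le hWδ
  have h3 : (variance (μ t) (μ t) + ENNReal.ofReal (H * ((t : ℝ) - s))) ^ (1 / 2 : ℝ) ≤
      ENNReal.ofReal (Real.sqrt (V + H * δ)) := by
    refine hsq (by positivity) ?_
    rw [ENNReal.ofReal_add hV (by positivity)]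
    exact add_le_add hVar hHts
  have h4 : (variance (μ t) (μ t)) ^ (1 / 2 : ℝ) ≤ ENNReal.ofReal (Real.sqrt V) := hsq hV hVar
  calc ((ENNReal.ofReal (H * ((t : ℝ) - s))) ^ (1 / 2 : ℝ) + ENNReal.ofReal (3 * δ)) +
      2 * ((μ t (thickening δ W)ᶜ) ^ (1 / 2 : ℝ) *
          ((variance (μ t) (μ t) + ENNReal.ofReal (H * ((t : ℝ) - s))) ^ (1 / 2 : ℝ) +
            (variance (μ t) (μ t)) ^ (1 / 2 : ℝ)) +
        ENNReal.ofReal (3 * δ) * μ t (thickening δ W)ᶜ)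
      ≤ (ENNReal.ofReal (Real.sqrt (H * δ)) + ENNReal.ofReal (3 * δ)) +
        2 * (ENNReal.ofReal (Real.sqrt δ) *
          (ENNReal.ofReal (Real.sqrt (V + H * δ)) + ENNReal.ofReal (Real.sqrt V)) +
          ENNReal.ofReal (3 * δ) * ENNReal.ofReal δ) := by gcongr
    _ = ENNReal.ofReal (Real.sqrt (H * δ) + 3 * δ +
        2 * (Real.sqrt δ * (Real.sqrt (V + H * δ) + Real.sqrt V) + 3 * δ * δ)) := by
        have e1 := @ENNReal.ofReal_add (Real.sqrt (H * δ) + 3 * δ)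
          (2 * (Real.sqrt δ * (Real.sqrt (V + H * δ) + Real.sqrt V) + 3 * δ * δ))
          (by positivity) (by positivity)
        have e2 := @ENNReal.ofReal_add (Real.sqrt (H * δ)) (3 * δ) (Real.sqrt_nonneg _) (by positivity)
        have e3 := @ENNReal.ofReal_mul 2
          (Real.sqrt δ * (Real.sqrt (V + H * δ) + Real.sqrt V) + 3 * δ * δ) (by norm_num)
        have e4 := @ENNReal.ofReal_add (Real.sqrt δ * (Real.sqrt (V + H * δ) + Real.sqrt V))
          (3 * δ * δ) (by positivity) (by positivity)
        have e5 := @ENNReal.ofReal_mul (Real.sqrt δ) (Real.sqrt (V + H * δ) + Real.sqrt V)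
          (Real.sqrt_nonneg _)
        have e6 := @ENNReal.ofReal_add (Real.sqrt (V + H * δ)) (Real.sqrt V) (Real.sqrt_nonneg _)
          (Real.sqrt_nonneg _)
        have e7 := @ENNReal.ofReal_mul (3 * δ) δ (by positivity)
        rw [e1, e2, e3, e4, e5, e6, e7, ENNReal.ofReal_ofNat]

end MetricFlow

end Literature.Geometry.Riemannian

end
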